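import Mathlib
import Literature.Topology.Euclidean.PlanarStaircase
import HarnessLib

/-!
# The coupled limit system at critical size: a one-variable reduction, I (a real zero)

Zilber's Exponential-Algebraic Closedness, case ladder (host summit Schanuel, cell `pub-schanuel`,
seat 2, gen 14).  At the critical size over a real plane `x₂ = r₀x₀ + (1/e - r₀)x₁ + c` with two
fibre polynomials `F₀, F₁` of degree `≤ e - 1` (`aⱼ =` the coefficient of `u^{e-1}` in `Fⱼ`,
`a₀ ≠ 0`) the diagonal-ray ansatz leads (after rescaling) to the COUPLED limit system

  `e^{ρⱼ} = P + aⱼ e^{K + αρ₀ + (1-α)ρ₁}`   (`j = 0, 1`;  `P = 2πiep`, `K = ec`, `α = er₀ ∉ ℚ`).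

Unlike the equal case `a₀ = a₁` (gen 13) it is not explicitly solvable.  THE REDUCTION: put
`t = αρ₀ + (1-α)ρ₁`, `Eⱼ(t) = P + aⱼe^{K+t}`; a solution is a `t` with `e^{ρⱼ} = Eⱼ(t)` for SOME
logarithms `ρⱼ` of `Eⱼ(t)` satisfying `αρ₀ + (1-α)ρ₁ = t`, i.e. with

  `Φ(t) := α log E₀(t) + (1-α) log E₁(t) - t ∈ -2πi(αℤ + ℤ)`   (any local branches),

a DENSE subset of `iℝ` (`α ∉ ℚ`).  So one needs points with `Re Φ(t) = 0`, where
`Re Φ(t) = g(t) := α log‖E₀(t)‖ + (1-α) log‖E₁(t)‖ - Re t` is single-valued — this file — and then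
the open mapping / local inverse of `Φ` to hit the dense target set exactly
(`ZilberEacCriticalFibresSupply`).

**`exists_re_zero_criticalFibres`** (`a₀ ≠ 0`, `α ≠ 0`, `P ≠ 0`): there is `t` with `E₀(t) ≠ 0`,
`E₁(t) ≠ 0`, `g(t) = 0`.  Proof: `g → +∞` as `Re t → -∞` (`criticalFibres_farLeft`); a point with
`g < 0` exists either near a zero of some `Eⱼ` whose coefficient (`α` resp. `1-α`) is positive
(`criticalFibres_dip`: `log‖Eⱼ‖ → -∞`) or, when `a₁ = 0` and `α < 0`, far to the right
(`criticalFibres_farRight`: `g ≈ (α-1)Re t`); the domain `{E₀ ≠ 0, E₁ ≠ 0}` is the complement of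
a countable set, hence path connected (`Literature.Topology.Euclidean.one_lt_rank_real_complex`,
`Set.Countable.isPathConnected_compl_of_one_lt_rank`), and the intermediate value theorem on it
finishes.

HONEST FRAMING: a lemma toward explicit members of an OPEN cell (`ECCell 3 2`);
NOT Schanuel's conjecture; EAC ⇏ SC.
-/

noncomputable section

open Complex Filter Topology

set_option linter.dupNamespace false

namespace Summit.Schanuel.Schanuel.Theorems

section Zero

/-- The domain `{E₀ ≠ 0, E₁ ≠ 0}` of the reduction is the complement of a countable set, hence
preconnected. [folklore] -/
theorem isPreconnected_criticalFibres_domain (a₀ a₁ K : ℂ) {P : ℂ} (hP : P ≠ 0) :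
    IsPreconnected {t : ℂ | P + a₀ * exp (K + t) ≠ 0 ∧ P + a₁ * exp (K + t) ≠ 0} := by
  have hsub : ∀ a : ℂ, ({w : ℂ | P + a * w = 0}).Subsingleton := by
    intro a w hw w' hw'
    simp only [Set.mem_setOf_eq] at hw hw'
    have ha : a ≠ 0 := by
      rintro rfl
      rw [zero_mul, add_zero] at hw
      exact hP hw
    exact mul_left_cancel₀ ha (by linear_combination hw - hw')
  have hS : ({w : ℂ | P + a₀ * w = 0} ∪ {w : ℂ | P + a₁ * w = 0}).Countable :=
    ((hsub a₀).countable).union ((hsub a₁).countable)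
  have hc : ({t : ℂ | P + a₀ * exp (K + t) ≠ 0 ∧ P + a₁ * exp (K + t) ≠ 0}ᶜ).Countable := by
    have hpre := (Complex.countable_preimage_exp.2 hS).preimage (add_right_injective K)
    refine hpre.mono fun t ht => ?_
    simp only [Set.mem_compl_iff, Set.mem_setOf_eq, not_and_or, not_not] at ht
    simpa [Set.mem_preimage, Set.mem_union, Set.mem_setOf_eq] using ht
  have hpc := Set.Countable.isPathConnected_compl_of_one_lt_rank
    Literature.Topology.Euclidean.one_lt_rank_real_complex hc
  rw [compl_compl] at hpc
  exact hpc.isConnected.isPreconnected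

/-- `g` is continuous on the domain. [folklore] -/
theorem continuousOn_criticalFibres_re (a₀ a₁ : ℂ) (α : ℝ) (K P : ℂ) :
    ContinuousOn (fun t : ℂ => α * Real.log ‖P + a₀ * exp (K + t)‖ +
        (1 - α) * Real.log ‖P + a₁ * exp (K + t)‖ - t.re)
      {t : ℂ | P + a₀ * exp (K + t) ≠ 0 ∧ P + a₁ * exp (K + t) ≠ 0} := by
  have hE : ∀ a : ℂ, Continuous fun t : ℂ => P + a * exp (K + t) := by
    intro a; fun_prop
  refine ((continuousOn_const.mul (((hE a₀).continuousOn.norm).log fun t ht =>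
      norm_ne_zero_iff.2 ht.1)).add (continuousOn_const.mul
        (((hE a₁).continuousOn.norm).log fun t ht => norm_ne_zero_iff.2 ht.2))).sub
    Complex.continuous_re.continuousOn

/-- **Far to the left `g > 0`**: for `Re t ≤ X₀` both `Eⱼ(t)` lie within `‖P‖/2` of `P ≠ 0`, so
the logarithms are bounded while `-Re t → +∞`. [folklore] -/
theorem criticalFibres_farLeft (a₀ a₁ : ℂ) (α : ℝ) (K : ℂ) {P : ℂ} (hP : P ≠ 0) :
    ∃ X₀ : ℝ, ∀ t : ℂ, t.re ≤ X₀ →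
      P + a₀ * exp (K + t) ≠ 0 ∧ P + a₁ * exp (K + t) ≠ 0 ∧
      0 < α * Real.log ‖P + a₀ * exp (K + t)‖ + (1 - α) * Real.log ‖P + a₁ * exp (K + t)‖ - t.re := by
  have hPn : 0 < ‖P‖ := norm_pos_iff.2 hP
  set Am : ℝ := ‖a₀‖ + ‖a₁‖ + 1 with hAm
  have hAm0 : 0 < Am := by positivity
  set X₁ : ℝ := Real.log (‖P‖ / (2 * Am)) - K.re with hX₁
  set M : ℝ := |Real.log (‖P‖ / 2)| + |Real.log (3 * ‖P‖ / 2)| with hM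
  have hM0 : 0 ≤ M := by positivity
  refine ⟨min X₁ (-((|α| + |1 - α|) * M) - 1), fun t ht => ?_⟩
  have ht1 : t.re ≤ X₁ := ht.trans (min_le_left _ _)
  have ht2 : t.re ≤ -((|α| + |1 - α|) * M) - 1 := ht.trans (min_le_right _ _)
  -- the perturbations are at most `‖P‖/2`
  have hsmall : ∀ a : ℂ, ‖a‖ ≤ Am → ‖a * exp (K + t)‖ ≤ ‖P‖ / 2 := by
    intro a ha
    rw [norm_mul, Complex.norm_exp, Complex.add_re]
    have h1 : Real.exp (K.re + t.re) ≤ ‖P‖ / (2 * Am) := by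
      have : K.re + t.re ≤ Real.log (‖P‖ / (2 * Am)) := by rw [hX₁] at ht1; linarith
      calc Real.exp (K.re + t.re) ≤ Real.exp (Real.log (‖P‖ / (2 * Am))) := Real.exp_le_exp.2 this
        _ = ‖P‖ / (2 * Am) := Real.exp_log (by positivity)
    calc ‖a‖ * Real.exp (K.re + t.re) ≤ Am * (‖P‖ / (2 * Am)) :=
          mul_le_mul ha h1 (Real.exp_pos _).le hAm0.le
      _ = ‖P‖ / 2 := by field_simp
  have hbounds : ∀ a : ℂ, ‖a‖ ≤ Am →
      P + a * exp (K + t) ≠ 0 ∧ |Real.log ‖P + a * exp (K + t)‖| ≤ M := by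
    intro a ha
    have hs := hsmall a ha
    have hlow : ‖P‖ / 2 ≤ ‖P + a * exp (K + t)‖ := by
      have h4 : ‖P‖ ≤ ‖P + a * exp (K + t)‖ + ‖a * exp (K + t)‖ := by
        calc ‖P‖ = ‖(P + a * exp (K + t)) - a * exp (K + t)‖ := by rw [add_sub_cancel_right]
          _ ≤ ‖P + a * exp (K + t)‖ + ‖a * exp (K + t)‖ := norm_sub_le _ _
      linarith
    have hhigh : ‖P + a * exp (K + t)‖ ≤ 3 * ‖P‖ / 2 := by
      calc ‖P + a * exp (K + t)‖ ≤ ‖P‖ + ‖a * exp (K + t)‖ := norm_add_le _ _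
        _ ≤ ‖P‖ + ‖P‖ / 2 := by linarith
        _ = 3 * ‖P‖ / 2 := by ring
    have hpos : 0 < ‖P + a * exp (K + t)‖ := lt_of_lt_of_le (by positivity) hlow
    refine ⟨norm_pos_iff.1 hpos, abs_le.2 ⟨?_, ?_⟩⟩
    · have h1 : Real.log (‖P‖ / 2) ≤ Real.log ‖P + a * exp (K + t)‖ :=
        Real.log_le_log (by positivity) hlow
      have h2 : -M ≤ Real.log (‖P‖ / 2) := by
        rw [hM]
        have := neg_abs_le (Real.log (‖P‖ / 2))
        have := abs_nonneg (Real.log (3 * ‖P‖ / 2))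
        linarith
      linarith
    · have h1 : Real.log ‖P + a * exp (K + t)‖ ≤ Real.log (3 * ‖P‖ / 2) :=
        Real.log_le_log hpos hhigh
      have h2 : Real.log (3 * ‖P‖ / 2) ≤ M := by
        rw [hM]
        have := le_abs_self (Real.log (3 * ‖P‖ / 2))
        have := abs_nonneg (Real.log (‖P‖ / 2))
        linarith
      linarith
  obtain ⟨h0ne, h0b⟩ := hbounds a₀ (by rw [hAm]; have := norm_nonneg a₁; linarith)
  obtain ⟨h1ne, h1b⟩ := hbounds a₁ (by rw [hAm]; have := norm_nonneg a₀; linarith)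
  refine ⟨h0ne, h1ne, ?_⟩
  have hA : -(|α| * M) ≤ α * Real.log ‖P + a₀ * exp (K + t)‖ := by
    have h := abs_mul α (Real.log ‖P + a₀ * exp (K + t)‖)
    have h' : |α| * |Real.log ‖P + a₀ * exp (K + t)‖| ≤ |α| * M :=
      mul_le_mul_of_nonneg_left h0b (abs_nonneg α)
    have := neg_abs_le (α * Real.log ‖P + a₀ * exp (K + t)‖)
    linarith
  have hB : -(|1 - α| * M) ≤ (1 - α) * Real.log ‖P + a₁ * exp (K + t)‖ := by
    have h := abs_mul (1 - α) (Real.log ‖P + a₁ * exp (K + t)‖)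
    have h' : |1 - α| * |Real.log ‖P + a₁ * exp (K + t)‖| ≤ |1 - α| * M :=
      mul_le_mul_of_nonneg_left h1b (abs_nonneg _)
    have := neg_abs_le ((1 - α) * Real.log ‖P + a₁ * exp (K + t)‖)
    linarith
  nlinarith

/-- `log‖P(1 - e^u)‖ → -∞` as the real number `u → 0`, `u ≠ 0`. [folklore] -/
theorem tendsto_log_norm_mul_one_sub_exp {P : ℂ} (hP : P ≠ 0) :
    Tendsto (fun u : ℝ => Real.log ‖P * (1 - exp (u : ℂ))‖) (𝓝[≠] 0) atBot := by
  refine Real.tendsto_log_nhdsNE_zero.comp ?_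
  rw [tendsto_nhdsWithin_iff]
  constructor
  · have hc : Continuous fun u : ℝ => ‖P * (1 - exp (u : ℂ))‖ := by fun_prop
    have := (hc.tendsto 0).mono_left (nhdsWithin_le_nhds (s := ({0}ᶜ : Set ℝ)))
    simpa using this
  · filter_upwards [self_mem_nhdsWithin] with u hu
    simp only [Set.mem_compl_iff, Set.mem_singleton_iff] at hu ⊢
    change ‖P * (1 - exp (u : ℂ))‖ ≠ 0
    refine norm_ne_zero_iff.2 (mul_ne_zero hP (sub_ne_zero.2 ?_))
    intro h
    have h' : Real.exp u = 1 := by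
      have := congrArg Complex.re h.symm
      simpa [Complex.exp_ofReal_re] using this
    exact hu (Real.exp_eq_one_iff u |>.1 h')

/-- **The dip**: if `b₀ ≠ 0` and the coefficient `β` of `log‖P + b₀e^{K+t}‖` is positive, then `g`
takes negative values on the domain (near the zero `t* = log(-P/b₀) - K` of `P + b₀e^{K+t}`,
approached along the real direction). [folklore] -/
theorem criticalFibres_dip (b₀ b₁ : ℂ) (hb₀ : b₀ ≠ 0) {β : ℝ} (hβ : 0 < β) (K : ℂ) {P : ℂ}
    (hP : P ≠ 0) :
    ∃ t : ℂ, P + b₀ * exp (K + t) ≠ 0 ∧ P + b₁ * exp (K + t) ≠ 0 ∧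
      β * Real.log ‖P + b₀ * exp (K + t)‖ + (1 - β) * Real.log ‖P + b₁ * exp (K + t)‖ - t.re < 0 := by
  have hPb : -P / b₀ ≠ 0 := div_ne_zero (neg_ne_zero.2 hP) hb₀
  set ts : ℂ := log (-P / b₀) - K with hts
  have hexp : exp (K + ts) = -P / b₀ := by
    rw [hts, add_sub_cancel, Complex.exp_log hPb]
  -- along `t = t* + u`, `u` real: `E₀ = P(1 - e^u)`, `E₁ = P(1 - (b₁/b₀)e^u)`
  have hE0 : ∀ u : ℝ, P + b₀ * exp (K + (ts + u)) = P * (1 - exp (u : ℂ)) := by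
    intro u
    rw [← add_assoc, Complex.exp_add, hexp]
    field_simp
    ring
  have hE1 : ∀ u : ℝ, P + b₁ * exp (K + (ts + u)) = P * (1 - b₁ / b₀ * exp (u : ℂ)) := by
    intro u
    rw [← add_assoc, Complex.exp_add, hexp]
    field_simp
    ring
  have hre : ∀ u : ℝ, (ts + (u : ℂ)).re = ts.re + u := by intro u; simp
  -- `E₀ ≠ 0` for `u ≠ 0`
  have hE0ne : ∀ᶠ u : ℝ in 𝓝[≠] 0, P + b₀ * exp (K + (ts + u)) ≠ 0 := by
    filter_upwards [self_mem_nhdsWithin] with u hu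
    rw [hE0]
    refine mul_ne_zero hP (sub_ne_zero.2 ?_)
    intro h
    have h' : Real.exp u = 1 := by
      have := congrArg Complex.re h.symm
      simpa [Complex.exp_ofReal_re] using this
    exact hu (Real.exp_eq_one_iff u |>.1 h')
  have hlog0 : Tendsto (fun u : ℝ => Real.log ‖P + b₀ * exp (K + (ts + u))‖) (𝓝[≠] 0) atBot := by
    simpa only [hE0] using tendsto_log_norm_mul_one_sub_exp hP
  by_cases hb : b₁ = b₀
  · -- equal coefficients: `g = log‖E₀‖ - Re t`
    have hE1' : ∀ u : ℝ, P + b₁ * exp (K + (ts + u)) = P + b₀ * exp (K + (ts + u)) := by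
      intro u; rw [hb]
    have hg : Tendsto (fun u : ℝ => β * Real.log ‖P + b₀ * exp (K + (ts + u))‖ +
        (1 - β) * Real.log ‖P + b₁ * exp (K + (ts + u))‖ - (ts + (u : ℂ)).re) (𝓝[≠] 0) atBot := by
      have h1 : Tendsto (fun u : ℝ => Real.log ‖P + b₀ * exp (K + (ts + u))‖ + (-ts.re - u))
          (𝓝[≠] 0) atBot := by
        have hu : Tendsto (fun u : ℝ => -ts.re - u) (𝓝[≠] (0 : ℝ)) (𝓝 (-ts.re - 0)) :=
          ((continuous_const.sub continuous_id).tendsto 0).mono_left nhdsWithin_le_nhds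
        exact hlog0.atBot_add hu
      refine h1.congr fun u => ?_
      rw [hE1' u, hre]; ring
    obtain ⟨u, hu1, hu2⟩ := ((hg.eventually (eventually_lt_atBot 0)).and hE0ne).exists
    exact ⟨ts + u, hu2, by rw [hE1' u]; exact hu2, hu1⟩
  · -- different coefficients: the second logarithm stays bounded near `u = 0`
    have hq : 1 - b₁ / b₀ ≠ 0 := by
      intro h
      apply hb
      field_simp at h
      linear_combination -h
    have hE1lim : Tendsto (fun u : ℝ => P + b₁ * exp (K + (ts + u))) (𝓝[≠] 0)
        (𝓝 (P * (1 - b₁ / b₀))) := by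
      have hc : Continuous fun u : ℝ => P * (1 - b₁ / b₀ * exp (u : ℂ)) := by fun_prop
      have := (hc.tendsto 0).mono_left (nhdsWithin_le_nhds (s := ({0}ᶜ : Set ℝ)))
      simp only [Complex.ofReal_zero, Complex.exp_zero, mul_one] at this
      simpa only [hE1] using this
    have hE1ne0 : P * (1 - b₁ / b₀) ≠ 0 := mul_ne_zero hP hq
    have hE1ne : ∀ᶠ u : ℝ in 𝓝[≠] 0, P + b₁ * exp (K + (ts + u)) ≠ 0 :=
      hE1lim.eventually_ne hE1ne0
    have hlog1 : Tendsto (fun u : ℝ => (1 - β) * Real.log ‖P + b₁ * exp (K + (ts + u))‖ - ts.re - u)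
        (𝓝[≠] 0) (𝓝 ((1 - β) * Real.log ‖P * (1 - b₁ / b₀)‖ - ts.re - 0)) := by
      have hu : Tendsto (fun u : ℝ => u) (𝓝[≠] (0 : ℝ)) (𝓝 0) :=
        (continuous_id.tendsto 0).mono_left nhdsWithin_le_nhds
      exact ((tendsto_const_nhds.mul ((hE1lim.norm).log (norm_ne_zero_iff.2 hE1ne0))).sub
        tendsto_const_nhds).sub hu
    have hg : Tendsto (fun u : ℝ => β * Real.log ‖P + b₀ * exp (K + (ts + u))‖ +
        (1 - β) * Real.log ‖P + b₁ * exp (K + (ts + u))‖ - (ts + (u : ℂ)).re) (𝓝[≠] 0) atBot := by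
      have h1 := (hlog0.const_mul_atBot hβ).atBot_add hlog1
      refine h1.congr fun u => ?_
      rw [hre]; ring
    obtain ⟨u, ⟨hu1, hu2⟩, hu3⟩ :=
      (((hg.eventually (eventually_lt_atBot 0)).and hE0ne).and hE1ne).exists
    exact ⟨ts + u, hu2, hu3, hu1⟩

/-- **Far to the right** (`a₁ = 0`, `α < 1`): `g(x) = α log‖P + a₀e^{K+x}‖ + (1-α)log‖P‖ - x
≈ (α - 1)x → -∞`. [folklore] -/
theorem criticalFibres_farRight (a₀ : ℂ) (ha₀ : a₀ ≠ 0) {α : ℝ} (hα : α < 1) (K : ℂ) {P : ℂ}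
    (hP : P ≠ 0) :
    ∃ t : ℂ, P + a₀ * exp (K + t) ≠ 0 ∧ P + 0 * exp (K + t) ≠ 0 ∧
      α * Real.log ‖P + a₀ * exp (K + t)‖ + (1 - α) * Real.log ‖P + 0 * exp (K + t)‖ - t.re < 0 := by
  have hPn : 0 < ‖P‖ := norm_pos_iff.2 hP
  have ha₀n : 0 < ‖a₀‖ := norm_pos_iff.2 ha₀
  set X₂ : ℝ := Real.log (2 * ‖P‖ / ‖a₀‖) - K.re with hX₂
  set B : ℝ := |α| * (|Real.log ‖a₀‖| + |K.re| + Real.log 2) + |1 - α| * |Real.log ‖P‖| with hB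
  have hB0 : 0 ≤ B := by positivity
  set x : ℝ := max X₂ (B / (1 - α) + 1) with hx
  have hx1 : X₂ ≤ x := le_max_left _ _
  have hx2 : B / (1 - α) + 1 ≤ x := le_max_right _ _
  have h1α : 0 < 1 - α := by linarith
  -- size of the main term
  set Q : ℝ := ‖a₀‖ * Real.exp (K.re + x) with hQ
  have hQpos : 0 < Q := by positivity
  have hQ2 : 2 * ‖P‖ ≤ Q := by
    have : Real.log (2 * ‖P‖ / ‖a₀‖) ≤ K.re + x := by rw [hX₂] at hx1; linarith
    have h := Real.exp_le_exp.2 this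
    rw [Real.exp_log (by positivity)] at h
    rw [hQ]
    have := (div_le_iff₀ ha₀n).1 h
    linarith
  have hnormQ : ‖a₀ * exp (K + (x : ℂ))‖ = Q := by
    rw [norm_mul, Complex.norm_exp, Complex.add_re, Complex.ofReal_re]
  have hlow : Q / 2 ≤ ‖P + a₀ * exp (K + (x : ℂ))‖ := by
    have h4 : Q ≤ ‖P + a₀ * exp (K + (x : ℂ))‖ + ‖P‖ := by
      calc Q = ‖a₀ * exp (K + (x : ℂ))‖ := hnormQ.symm
        _ = ‖(P + a₀ * exp (K + (x : ℂ))) - P‖ := by ring_nf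
        _ ≤ ‖P + a₀ * exp (K + (x : ℂ))‖ + ‖P‖ := norm_sub_le _ _
    linarith
  have hhigh : ‖P + a₀ * exp (K + (x : ℂ))‖ ≤ 2 * Q := by
    calc ‖P + a₀ * exp (K + (x : ℂ))‖ ≤ ‖P‖ + ‖a₀ * exp (K + (x : ℂ))‖ := norm_add_le _ _
      _ ≤ 2 * Q := by rw [hnormQ]; linarith
  have hpos : 0 < ‖P + a₀ * exp (K + (x : ℂ))‖ := lt_of_lt_of_le (by positivity) hlow
  -- `log‖E₀‖ = log‖a₀‖ + K.re + x + θ`, `|θ| ≤ log 2`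
  have hlogQ : Real.log Q = Real.log ‖a₀‖ + (K.re + x) := by
    rw [hQ, Real.log_mul ha₀n.ne' (Real.exp_pos _).ne', Real.log_exp]
  have hθ : |Real.log ‖P + a₀ * exp (K + (x : ℂ))‖ - (Real.log ‖a₀‖ + K.re + x)| ≤ Real.log 2 := by
    have hl : Real.log (Q / 2) ≤ Real.log ‖P + a₀ * exp (K + (x : ℂ))‖ :=
      Real.log_le_log (by positivity) hlow
    have hh : Real.log ‖P + a₀ * exp (K + (x : ℂ))‖ ≤ Real.log (2 * Q) :=
      Real.log_le_log hpos hhigh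
    rw [Real.log_div hQpos.ne' two_ne_zero, hlogQ] at hl
    rw [Real.log_mul two_ne_zero hQpos.ne', hlogQ] at hh
    rw [abs_le]
    constructor <;> linarith
  refine ⟨(x : ℂ), norm_pos_iff.1 hpos, by rw [zero_mul, add_zero]; exact hP, ?_⟩
  rw [zero_mul, add_zero, Complex.ofReal_re]
  -- `g ≤ (α - 1)x + B < 0`
  set θ : ℝ := Real.log ‖P + a₀ * exp (K + (x : ℂ))‖ - (Real.log ‖a₀‖ + K.re + x) with hθdef
  have hmain : α * Real.log ‖P + a₀ * exp (K + (x : ℂ))‖ =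
      α * x + α * (Real.log ‖a₀‖ + K.re + θ) := by rw [hθdef]; ring
  have hb1 : α * (Real.log ‖a₀‖ + K.re + θ) ≤ |α| * (|Real.log ‖a₀‖| + |K.re| + Real.log 2) := by
    have h1 : |Real.log ‖a₀‖ + K.re + θ| ≤ |Real.log ‖a₀‖| + |K.re| + Real.log 2 := by
      have := abs_add_le (Real.log ‖a₀‖ + K.re) θ
      have := abs_add_le (Real.log ‖a₀‖) K.re
      linarith
    calc α * (Real.log ‖a₀‖ + K.re + θ) ≤ |α * (Real.log ‖a₀‖ + K.re + θ)| := le_abs_self _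
      _ = |α| * |Real.log ‖a₀‖ + K.re + θ| := abs_mul _ _
      _ ≤ |α| * (|Real.log ‖a₀‖| + |K.re| + Real.log 2) :=
          mul_le_mul_of_nonneg_left h1 (abs_nonneg α)
  have hb2 : (1 - α) * Real.log ‖P‖ ≤ |1 - α| * |Real.log ‖P‖| := by
    calc (1 - α) * Real.log ‖P‖ ≤ |(1 - α) * Real.log ‖P‖| := le_abs_self _
      _ = |1 - α| * |Real.log ‖P‖| := abs_mul _ _
  have hxB : B < (1 - α) * x := by
    have : B / (1 - α) < x := by linarith
    exact (div_lt_iff₀ h1α).1 this |>.trans_eq (mul_comm _ _)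
  rw [hmain]
  nlinarith

/-- **A real zero of the reduction.**  `a₀ ≠ 0`, `α ≠ 0`, `P ≠ 0`: there is `t` with
`E₀(t), E₁(t) ≠ 0` and `g(t) = α log‖E₀(t)‖ + (1-α) log‖E₁(t)‖ - Re t = 0`. (new) -/
theorem exists_re_zero_criticalFibres (a₀ a₁ : ℂ) (ha₀ : a₀ ≠ 0) {α : ℝ} (hα : α ≠ 0) (K : ℂ)
    {P : ℂ} (hP : P ≠ 0) :
    ∃ t : ℂ, P + a₀ * exp (K + t) ≠ 0 ∧ P + a₁ * exp (K + t) ≠ 0 ∧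
      α * Real.log ‖P + a₀ * exp (K + t)‖ + (1 - α) * Real.log ‖P + a₁ * exp (K + t)‖ - t.re = 0 := by
  -- a point of the domain with `g < 0`
  have hneg : ∃ t : ℂ, P + a₀ * exp (K + t) ≠ 0 ∧ P + a₁ * exp (K + t) ≠ 0 ∧
      α * Real.log ‖P + a₀ * exp (K + t)‖ + (1 - α) * Real.log ‖P + a₁ * exp (K + t)‖ - t.re < 0 := by
    rcases lt_or_gt_of_ne hα with hαneg | hαpos
    · by_cases ha₁ : a₁ = 0
      · subst ha₁
        exact criticalFibres_farRight a₀ ha₀ (by linarith) K hP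
      · obtain ⟨t, h1, h0, hg⟩ := criticalFibres_dip a₁ a₀ ha₁ (β := 1 - α) (by linarith) K hP
        exact ⟨t, h0, h1, by linarith⟩
    · exact criticalFibres_dip a₀ a₁ ha₀ hαpos K hP
  obtain ⟨t₁, h₁0, h₁1, hg₁⟩ := hneg
  obtain ⟨X₀, hX₀⟩ := criticalFibres_farLeft a₀ a₁ α K hP
  obtain ⟨h₂0, h₂1, hg₂⟩ := hX₀ (X₀ : ℂ) (by simp)
  have hD := isPreconnected_criticalFibres_domain a₀ a₁ K hP
  have hcont := continuousOn_criticalFibres_re a₀ a₁ α K P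
  have hIcc := hD.intermediate_value (a := t₁) (b := (X₀ : ℂ)) ⟨h₁0, h₁1⟩ ⟨h₂0, h₂1⟩ hcont
  obtain ⟨t, ⟨ht0, ht1⟩, hgt⟩ := hIcc ⟨hg₁.le, hg₂.le⟩
  exact ⟨t, ht0, ht1, hgt⟩

end Zero

end Summit.Schanuel.Schanuel.Theorems

end
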